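import Literature.NumberTheory.Automorphic.TwistedQuotientLevelProdSemilinear
import Literature.NumberTheory.Automorphic.TwistedQuotientRestrictScalars
import HarnessLib

/-!
# `H^q(Γ, W^{L/L'})` injects along a split injection of the values (change of coefficient ring)

Topic `NumberTheory/Automorphic`; namespace `Literature.NumberTheory.Automorphic.TwistedQuotient`.
Theorems only; no definition, no named fact, no instance, no `sorry`.

Continuation of `TwistedQuotientLevelProdSemilinear` (the `τ`-semilinear comparison
`hKerSemimap e : W^{L/L'} → W'^{L/L'}`, `W = Fun(𝒢 ⧸ L', N)`, along `e : N →ₛₗ[τ] N'`).  There the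
induced map `Hⁿ(e)` on `H^q(Γ, W^{L/L'})` is shown bijective when `e` is.  Here: **`Hⁿ(e)` is
INJECTIVE as soon as `e` admits a `k`-linear, `L/L'`-equivariant RETRACTION** `r : N' → N`
(`N'` regarded as a `k`-module through `τ : k → k'`), `r ∘ e = id`
(`semimap_hKerSemimap_injective_of_retraction`).  Proof: over `k`, `Hⁿ(r) ∘ Hⁿ(e) = Hⁿ(id) = id`
(`semimap_injective_of_leftInverse`) for the restriction of scalars `resScalars k σ'` of the values,
and the comparison `H^q_k(Γ, W'^{L/L'}) → H^q_{k'}(Γ, W'^{L/L'})` of the two cohomologies of the same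
module is bijective (`hKerSemimap_bijective` for the identity).

Use (`[Scholze2015, §V.4]`, passage from a Noetherian coefficient ring `𝒪_{E'}` to `ℤ̄_p`):
`𝒪_{E'}/p^t ↪ ℤ̄_p/p^t` splits `𝒪_{E'}`-linearly (`RingTheory/DiscreteValuationRing/
QuotientSelfInjective`), so the reduced integral structures over `𝒪_{E'}` inject into those over
`ℤ̄_p`, Hecke-equivariantly (`semimap_map_endo`, `hKerSemimap_φZ_heckePolyTwist`).

## References

* K. S. Brown, *Cohomology of Groups*, GTM 87 (1982), III.1 Example 3. [Brown1982CohomologyGroups]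
* P. Scholze, Ann. of Math. 182 (2015), §V.4. [Scholze2015]
-/

noncomputable section

open CategoryTheory Literature.Algebra.Homology

universe u

namespace Literature.NumberTheory.Automorphic

namespace TwistedQuotient

variable {k k' : Type u} [CommRing k] [CommRing k'] [Algebra k k'] {Γ 𝒢 : Type u} [Group Γ]
  [Group 𝒢] (ι : Γ →* 𝒢) {L' L : Subgroup 𝒢} (hle : L' ≤ L) [hN : (L'.subgroupOf L).Normal]
  {N : Type u} [AddCommGroup N] [Module k N] {N' : Type u} [AddCommGroup N'] [Module k' N']
  [Module k N'] [IsScalarTower k k' N']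
  (σ : Representation k (L ⧸ L'.subgroupOf L) N) (σ' : Representation k' (L ⧸ L'.subgroupOf L) N')
  (e : N →ₛₗ[algebraMap k k'] N')
  (he : ∀ (h : L ⧸ L'.subgroupOf L) (v : N), e (σ h v) = σ' h (e v))
  (r : N' →ₗ[k] N) (hr : ∀ (h : L ⧸ L'.subgroupOf L) (w : N'), r (σ' h w) = σ h (r w))
  (hre : ∀ v : N, r (e v) = v)

include hr in
/-- The retraction `r` is equivariant for the restriction of scalars of `σ'`. [folklore] -/
theorem retraction_equivariant (h : L ⧸ L'.subgroupOf L) (w : N') :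
    r (resScalars k σ' h w) = σ h (r w) := by
  rw [resScalars_apply, hr]

include he hr hre in
/-- **`Hⁿ(e) : H^q_k(Γ, W^{L/L'}) → H^q_{k'}(Γ, W'^{L/L'})` is injective when `e` has a `k`-linear
equivariant retraction.** [cite: Brown1982CohomologyGroups, III.1 Example 3]
[cite: Scholze2015, §V.4 (proof of Thm. V.4.1)] -/
theorem semimap_hKerSemimap_injective_of_retraction (q : ℕ) :
    Function.Injective (semimap (hKerSemimap ι hle σ σ' e he)
      (hKerSemimap_equivariant ι hle σ σ' e he) q) := by
  -- the identity semilinear map of `N'` and the `k`-linear version of `e`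
  let j : N' →ₛₗ[algebraMap k k'] N' :=
    { toFun := id, map_add' := fun _ _ => rfl, map_smul' := fun c x => (algebraMap_smul k' c x).symm }
  have hj : ∀ (h : L ⧸ L'.subgroupOf L) (w : N'), j (resScalars k σ' h w) = σ' h (j w) := fun _ _ => rfl
  let e₀ : N →ₗ[k] N' :=
    { toFun := e, map_add' := map_add e,
      map_smul' := fun c v => by rw [map_smulₛₗ e, RingHom.id_apply, algebraMap_smul] }
  have he₀ : ∀ (h : L ⧸ L'.subgroupOf L) (v : N), e₀ (σ h v) = resScalars k σ' h (e₀ v) :=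
    fun h v => by change e (σ h v) = σ' h (e v); exact he h v
  have hr₀ : ∀ (h : L ⧸ L'.subgroupOf L) (w : N'), r (resScalars k σ' h w) = σ h (r w) :=
    retraction_equivariant σ σ' r hr
  -- the three comparison maps on `W^{L/L'}`
  let s₀ := hKerSemimap ι hle σ (resScalars k σ') e₀ he₀
  let s₁ := hKerSemimap ι hle (resScalars k σ') σ' j hj
  let sᵣ := hKerSemimap ι hle (resScalars k σ') σ r hr₀
  have h0 := hKerSemimap_equivariant ι hle σ (resScalars k σ') e₀ he₀
  have h1 := hKerSemimap_equivariant ι hle (resScalars k σ') σ' j hj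
  have hR := hKerSemimap_equivariant ι hle (resScalars k σ') σ r hr₀
  -- `Hⁿ(e) = Hⁿ(j) ∘ Hⁿ(e₀)`
  have hcomp : ∀ x, semimap (hKerSemimap ι hle σ σ' e he) (hKerSemimap_equivariant ι hle σ σ' e he) q x =
      semimap s₁ h1 q (semimap s₀ h0 q x) := fun x =>
    (semimap_semimap s₀ h0 s₁ h1 _ (hKerSemimap_equivariant ι hle σ σ' e he)
      (fun f => Subtype.ext (funext fun y => funext fun c => rfl)) q x).symm
  -- `Hⁿ(e₀)` is injective (retraction `Hⁿ(r)`), `Hⁿ(j)` is bijective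
  have hinj₀ : Function.Injective (semimap s₀ h0 q) :=
    semimap_injective_of_leftInverse s₀ h0 sᵣ hR
      (fun f => Subtype.ext (funext fun y => funext fun c => by
        rw [val_hKerSemimap, val_hKerSemimap]; exact hre _)) q
  have hinj₁ : Function.Injective (semimap s₁ h1 q) :=
    semimap_injective_of_bijective s₁ h1
      (hKerSemimap_bijective ι hle (resScalars k σ') σ' j hj Function.bijective_id) q
  intro x y hxy
  rw [hcomp, hcomp] at hxy
  exact hinj₀ (hinj₁ hxy)

end TwistedQuotient

end Literature.NumberTheory.Automorphic
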